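import Summits.Ventures.PercRepro.C041BlockMapClosure

/-!
# ROW C-041 — THEOREM (UNIT EXIT): an exit loaded with the unit vector `𝟙` is invisible to the block map, so
CONJECTURE (BLOCK MAP) is monotone in the set of exits (p6, gen 35)

Setting of `C041BlockMapHangTools` (the host `Z₁` with the extra exit `v` in the slot `none`: exits
`uplus u v : Option ι → V₁`, inputs `wplus X w`) and `C041BlockMapClosure` (`ConeHost`).  The unit vector `𝟙`
is fixed by `θ_B` and `θ_R` (`thB_one`, `thR_one`), so an exit carrying `𝟙` contributes the factor `𝟙` whether
merged or separated, and a block consisting of that exit alone contributes `θ_R 𝟙 = 𝟙`.  Hence the merged set and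
the blocks of the exits `u` are those of `uplus u v` with `none` erased (`merged_eraseNone`, `blk_eraseNone`,
`blocks_subset_image`, `eq_empty_or_mem_blocks`, the erasure being injective on the blocks by their
disjointness), the products agree (`prod_merged_uplus`, `prod_blocks_uplus`), and so does every colouring term
(`colTerm_unit`): **`blockMap_unit`: `blockMap Z₁ (uplus u v) a₁ (wplus 𝟙 w) = blockMap Z₁ u a₁ w`**.
COROLLARY (`coneHost_of_coneHost_uplus`): a cone host with an extra exit is a cone host without it —
CONJECTURE (BLOCK MAP) for a host with more exits implies it for fewer (the extra exit is loaded with the cone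
member `𝟙`); in particular the hypothesis `ConeHost Za (uplus u₁ v) a₁` of THEOREM (HANG) is at least as strong
as `ConeHost Za u₁ a₁`.
-/

namespace PercRepro

namespace ZoneZ

namespace MultiExit

open ZoneData Pendant Finset TwoExit TreeClosure

/-! ## The unit vector -/

/-- `θ_B` fixes the unit vector. -/
theorem thB_one : thB (1 : Vec6) = 1 := by
  funext i
  fin_cases i <;> simp [thB]

/-- `exitOf` of the unit vector is the unit vector, whatever the reach flag. -/
theorem exitOf_one (r : Prop) : exitOf (1 : Vec6) r = 1 := by
  unfold exitOf
  by_cases hr : r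
  · rw [if_pos hr]
  · rw [if_neg hr, thB_one]

variable {ι V₁ E₁ U₁ U₂ : Type} (Z₁ : ZoneData V₁ E₁ U₁ U₂) (u : ι → V₁) (a₁ : V₁) (v : V₁) [Fintype ι]
  [DecidableEq ι]

/-! ## The merged set and the blocks with the extra exit erased -/

section Sets

variable (ω : E₁ → Bool)

omit [DecidableEq ι] in
/-- The merged exits of `u` are the merged exits of `uplus u v` with `none` erased. -/
theorem merged_eraseNone : Finset.eraseNone (merged Z₁ (uplus u v) a₁ ω) = merged Z₁ u a₁ ω := by
  ext k
  rw [Finset.mem_eraseNone, mem_merged, mem_merged, uplus_some]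

omit [DecidableEq ι] in
/-- The block of an old exit is its block among the exits `uplus u v` with `none` erased. -/
theorem blk_eraseNone (k : ι) :
    Finset.eraseNone (blk Z₁ (uplus u v) a₁ ω (some k)) = blk Z₁ u a₁ ω k := by
  ext l
  rw [Finset.mem_eraseNone, mem_blk, mem_blk, uplus_some, uplus_some]

omit [DecidableEq ι] in
/-- Every block is nonempty. -/
theorem nonempty_of_mem_blocks {B : Finset ι} (hB : B ∈ blocks Z₁ u a₁ ω) : B.Nonempty := by
  rw [mem_blocks] at hB
  obtain ⟨k, hk, rfl⟩ := hB
  exact ⟨k, self_mem_blk Z₁ u a₁ ω k hk⟩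

/-- Every block of `u` is a block of `uplus u v` with `none` erased. -/
theorem blocks_subset_image :
    blocks Z₁ u a₁ ω ⊆ (blocks Z₁ (uplus u v) a₁ ω).image Finset.eraseNone := by
  intro B hB
  rw [mem_blocks] at hB
  obtain ⟨k, hk, rfl⟩ := hB
  rw [Finset.mem_image]
  exact ⟨blk Z₁ (uplus u v) a₁ ω (some k), (mem_blocks _ _ _ _ _).2 ⟨some k, hk, rfl⟩,
    blk_eraseNone Z₁ u a₁ v ω k⟩

/-- A block of `uplus u v` with `none` erased is empty or a block of `u`. -/
theorem eq_empty_or_mem_blocks (S : Finset ι) (hS : S ∈ (blocks Z₁ (uplus u v) a₁ ω).image Finset.eraseNone) :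
    S = ∅ ∨ S ∈ blocks Z₁ u a₁ ω := by
  rw [Finset.mem_image] at hS
  obtain ⟨B, hB, rfl⟩ := hS
  rw [mem_blocks] at hB
  obtain ⟨o, ho, rfl⟩ := hB
  cases o with
  | none =>
    by_cases hS : Finset.eraseNone (blk Z₁ (uplus u v) a₁ ω none) = ∅
    · exact Or.inl hS
    · right
      obtain ⟨k, hk⟩ := Finset.nonempty_iff_ne_empty.2 hS
      rw [Finset.mem_eraseNone] at hk
      have hsep : ¬ Z₁.Mg a₁ (u k) ω := ((mem_blk _ _ _ _ _ _).1 hk).1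
      rw [← blk_eq_of_mem Z₁ (uplus u v) a₁ ω hk, blk_eraseNone Z₁ u a₁ v ω k, mem_blocks]
      exact ⟨k, hsep, rfl⟩
  | some k =>
    right
    rw [blk_eraseNone Z₁ u a₁ v ω k, mem_blocks]
    exact ⟨k, ho, rfl⟩

omit [DecidableEq ι] in
/-- Erasing `none` is injective on the blocks of `uplus u v`: two distinct blocks are disjoint, and a block is
nonempty. -/
theorem injOn_eraseNone_blocks :
    Set.InjOn Finset.eraseNone (blocks Z₁ (uplus u v) a₁ ω : Set (Finset (Option ι))) := by
  intro B₁ hB₁ B₂ hB₂ h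
  by_contra hne
  have hdis := blocks_pairwise Z₁ (uplus u v) a₁ ω B₁ hB₁ B₂ hB₂ hne
  rw [Finset.disjoint_left] at hdis
  obtain ⟨o₁, ho₁⟩ := nonempty_of_mem_blocks Z₁ (uplus u v) a₁ ω hB₁
  obtain ⟨o₂, ho₂⟩ := nonempty_of_mem_blocks Z₁ (uplus u v) a₁ ω hB₂
  cases o₁ with
  | some k =>
    have hk : k ∈ Finset.eraseNone B₂ := by
      rw [← h, Finset.mem_eraseNone]
      exact ho₁
    rw [Finset.mem_eraseNone] at hk
    exact hdis ho₁ hk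
  | none =>
    cases o₂ with
    | some k =>
      have hk : k ∈ Finset.eraseNone B₁ := by
        rw [h, Finset.mem_eraseNone]
        exact ho₂
      rw [Finset.mem_eraseNone] at hk
      exact hdis hk ho₂
    | none => exact hdis ho₁ ho₂

end Sets

/-! ## The products -/

section Products

variable (ω : E₁ → Bool) (f : Option ι → Vec6)

omit [DecidableEq ι] in
/-- The product over the merged exits of `uplus u v` of a function that is `𝟙` on `none` is the product over the
merged exits of `u`. -/
theorem prod_merged_uplus (h0 : f none = 1) :
    ∏ o ∈ merged Z₁ (uplus u v) a₁ ω, f o = ∏ k ∈ merged Z₁ u a₁ ω, f (some k) := by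
  rw [← merged_eraseNone Z₁ u a₁ v ω, Finset.prod_eraseNone]
  refine Finset.prod_congr rfl fun o _ => ?_
  cases o with
  | none => exact h0
  | some k => rfl

/-- The product over the blocks of `uplus u v` of `θ_R` of the block products of a function that is `𝟙` on `none`
is the product over the blocks of `u`. -/
theorem prod_blocks_uplus (h0 : f none = 1) :
    ∏ B ∈ blocks Z₁ (uplus u v) a₁ ω, thR (∏ o ∈ B, f o) =
      ∏ B ∈ blocks Z₁ u a₁ ω, thR (∏ k ∈ B, f (some k)) := by
  have hsub : ∏ B ∈ blocks Z₁ u a₁ ω, thR (∏ k ∈ B, f (some k)) =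
      ∏ S ∈ (blocks Z₁ (uplus u v) a₁ ω).image Finset.eraseNone, thR (∏ k ∈ S, f (some k)) := by
    refine Finset.prod_subset (blocks_subset_image Z₁ u a₁ v ω) fun S hS hS' => ?_
    rcases eq_empty_or_mem_blocks Z₁ u a₁ v ω S hS with rfl | h
    · rw [Finset.prod_empty, thR_one]
    · exact absurd h hS'
  rw [hsub, Finset.prod_image (injOn_eraseNone_blocks Z₁ u a₁ v ω)]
  refine Finset.prod_congr rfl fun B _ => ?_
  rw [Finset.prod_eraseNone]
  congr 1
  refine Finset.prod_congr rfl fun o _ => ?_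
  cases o with
  | none => exact h0
  | some k => rfl

end Products

/-! ## THEOREM (UNIT EXIT) -/

section Main

variable (ω : E₁ → Bool)

omit [DecidableEq ι] in
/-- **The colouring term does not see an exit loaded with `𝟙`.** -/
theorem colTerm_unit (w : ι → Vec6) :
    colTerm Z₁ (uplus u v) a₁ ω (wplus 1 w) = colTerm Z₁ u a₁ ω w := by
  classical
  unfold colTerm
  rw [prod_merged_uplus Z₁ u a₁ v ω (fun o => exitOf (wplus 1 w o) (Z₁.Rd a₁ (uplus u v o) ω))
      (by rw [wplus_none, exitOf_one]),
    prod_blocks_uplus Z₁ u a₁ v ω (fun o => exitOf (wplus 1 w o) (Z₁.Rd a₁ (uplus u v o) ω))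
      (by rw [wplus_none, exitOf_one])]
  rfl

variable [Fintype E₁] [DecidableEq E₁]

omit [DecidableEq ι] in
/-- **THEOREM (UNIT EXIT)**: the block map of the host with the extra exit `v` loaded with `𝟙` is the block map
of the host without it. -/
theorem blockMap_unit (w : ι → Vec6) : blockMap Z₁ (uplus u v) a₁ (wplus 1 w) = blockMap Z₁ u a₁ w := by
  rw [blockMap_eq_sum_colTerm, blockMap_eq_sum_colTerm]
  exact Finset.sum_congr rfl fun ω _ => colTerm_unit Z₁ u a₁ v ω w

omit [DecidableEq ι] in
/-- **CONJECTURE (BLOCK MAP) is monotone in the exits**: a cone host with an extra exit `v` is a cone host without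
it. -/
theorem coneHost_of_coneHost_uplus (h : ConeHost Z₁ (uplus u v) a₁) : ConeHost Z₁ u a₁ := by
  intro w hw
  rw [← blockMap_unit Z₁ u a₁ v w]
  exact h _ (inCone_wplus 1 InCone_one w hw)

end Main

end MultiExit

end ZoneZ

end PercRepro
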